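import Summits.Ventures.CertifiedQuantumChemistry.Rows.SpinSectors
import Summits.Ventures.CertifiedQuantumChemistry.Rows.SingletRows
import HarnessLib

/-!
# Ventures/CertifiedQuantumChemistry — Rows/SingletVersusSector.lean: the closed-shell sector energy
# is the smaller of the SINGLET energy and the `S_z = 1` sector energy; certified spin of the ground state

HONEST FRAMING (verbatim): certified bounds for a stated model Hamiltonian in a stated basis; not a
claim about the real molecule beyond that model.

Typer (gen 6), zero compute, nothing landed is touched. `Statement.lean` keeps the singlet-restricted
rows (`SingletLowerRow` / `SingletUpperRow`, CERTIFIED.md keys `e0S0[…]`) and the sector rows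
(`LowerRow` / `UpperRow` at `(N_α, N_β) = (n, n)`) as DIFFERENT quantities, because
`Model.energy F n n ≤ Model.singletEnergy F n` (`Rows/SingletRows.lean`) is all that holds in general
("equality iff the `2n`-electron ground multiplet contains a singlet — NOT a theorem of the model").
This file proves the exact relation between the two and turns it into CERTIFIABLE row readings:

* `Model.energy_eq_min_singletEnergy_energy` — for a symmetric model, `1 ≤ n`, `n + 1 ≤ k`:
  **`E(n, n) = min ( E₀(N = 2n, S = 0), E(n + 1, n − 1) )`.**
  (`≤`: the singlet subspace and the `(n+1, n−1)` sector both sit above `E(n, n)` — tree facts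
  `Model.energy_le_singletEnergy`, `Model.energy_le_energy_of_max_le`. `≥`, the new half
  (`Model.min_singletEnergy_energy_le`, any `n ≤ k`): a ground vector `χ` of the `(n, n)` sector is an
  eigenvector of `H_F`; either `Ŝ_+ χ = 0`, so `χ` is a singlet trial state, or `Ŝ_+ χ ≠ 0` is an
  eigenvector with the SAME eigenvalue in the `(n+1, n−1)` sector (`[H_F, Ŝ_+] = 0`, HJO §2.3.4), a
  trial state there. Lieb–Mattis 1962 §I / Lieb 1989 proof of Thm 1 use the same one-step ladder.)
* ROW READINGS (the point). With ONE extra certified leg in the `S_z = 1` sector `(n + 1, n − 1)`: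
  - `SingletLowerRow.lowerRow_min` — a singlet `L` and an `(n+1, n−1)` sector `L` give the SECTOR
    lower row `LowerRow F n n (min lo lo')` (no spin assumption at all);
  - `SingletUpperRow.energy_eq_singletEnergy_of_gap` — **certified SINGLET ground state**: a singlet
    `U = hi` and an `(n+1, n−1)` sector `L = lo` with `hi < lo` prove `E(n, n) = E₀(2n, S = 0) <
    E(n+1, n−1)`; then every singlet row IS a sector row and an `N`-electron row
    (`SingletLowerRow.lowerRow_of_gap`, `SingletBracket.bracket_of_gap`,
    `SingletBracket.groundEnergy_mem_of_gap`), and every ground vector of the `(n, n)` sector is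
    annihilated by `Ŝ_+` (`spinPlus_mulVec_eq_zero_of_gap`: the model's `2n`-electron ground states
    in `S_z = 0` are singlets — a certified statement about the MODEL's ground-state spin);
  - `SingletLowerRow.energy_eq_energy_of_gap` — **certified NON-singlet ground state**: a singlet
    `L = lo` and an `(n+1, n−1)` sector `U = hi` with `hi < lo` prove `E(n, n) = E(n+1, n−1) <
    E₀(2n, S = 0)`; then an `(n+1, n−1)` bracket is an `(n, n)` bracket (`Bracket.bracket_pred_of_gap`)
    and hence an `E₀(2n)` bracket.
  No CERTIFIED.md row uses these today (no `S_z = 1` leg has been filed); they say what such a leg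
  would buy: the identification of the `e0S0` rows with sector / `E₀(N)` rows by certificate instead
  of by assumption (HOME/SCOPE.md §"general statement", bullet "singlet ≠ sector in general").
Everything is PROVED (0 sorry); no definition, no claim node; nothing in this file asserts any bound.
-/

noncomputable section

namespace Summit.Ventures.CertifiedQuantumChemistry

open Matrix Finset
open Literature.MathematicalPhysics.QuantumLattice Literature.MathematicalPhysics.QuantumChemistry
open scoped ComplexOrder

/-! ## Generic: a Hermitian `H` conserving `(N↑, N↓)` and commuting with `Ŝ_+` -/

section Generic

variable {Λ : Type*} [LinearOrder Λ] [Fintype Λ]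

/-- **One `Ŝ_+` step from the balanced sector.** For a Hermitian `H` commuting with `Ŝ_+` and an
eigenvector `χ` of `H` in the sector `(n, n)` with eigenvalue `E`: either `Ŝ_+ χ = 0` (`χ` is a
singlet), or `Ŝ_+ χ` is a nonzero eigenvector with eigenvalue `E` in the sector `(n + 1, n − 1)`, so
`E(n + 1, n − 1) ≤ E`. (Lieb–Mattis 1962 §I; Lieb, PRL 62 (1989) 1201, proof of Thm 1.) -/
theorem spinPlus_mulVec_eq_zero_or_sectorGroundEnergy_le
    {H : Matrix (Finset (Orb Λ)) (Finset (Orb Λ)) ℂ} (hH : H.IsHermitian) (hcommP : Commute H spinPlus)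
    {n : ℕ} {χ : Fock (Orb Λ)} (hχ : IsInSector n n χ) {E : ℝ} (hHχ : H *ᵥ χ = ((E : ℝ) : ℂ) • χ) :
    spinPlus *ᵥ χ = 0 ∨ sectorGroundEnergy H (n + 1) (n - 1) ≤ E := by
  by_cases h0 : spinPlus *ᵥ χ = 0
  · exact Or.inl h0
  · refine Or.inr ?_
    cases n with
    | zero => exact absurd (LiebThm1.raisesSpin_spinPlus.mulVec_eq_zero hχ) h0
    | succ m =>
      have hφs : IsInSector (m + 1 + 1) m (spinPlus *ᵥ χ) :=
        LiebThm1.raisesSpin_spinPlus.isInSector_mulVec hχ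
      have hHφ : H *ᵥ (spinPlus *ᵥ χ) = ((E : ℝ) : ℂ) • (spinPlus *ᵥ χ) := by
        rw [mulVec_mulVec, hcommP.eq, ← mulVec_mulVec, hHχ, mulVec_smul]
      have hle : sectorGroundEnergy H (m + 1 + 1) m ≤ E :=
        sectorGroundEnergy_le_of_rayleigh hH hφs h0
          (by rw [hHφ, dotProduct_smul, smul_eq_mul, Complex.re_ofReal_mul])
      simpa using hle

/-- **`min ( E_singlet(n), E(n + 1, n − 1) ) ≤ E(n, n)`** for a Hermitian `H` conserving `(N↑, N↓)`
and commuting with `Ŝ_+`, `n ≤ |Λ|`; here `E_singlet(n)` is the lowest energy of `H` on the singlet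
subspace `(n, n)-sector ⊓ ker Ŝ_+` (the `Statement.lean` definition of `Model.singletEnergy`). -/
theorem min_singlet_sector_le_sectorGroundEnergy
    {H : Matrix (Finset (Orb Λ)) (Finset (Orb Λ)) ℂ} (hH : H.IsHermitian) (hHs : PreservesSectors H)
    (hcommP : Commute H spinPlus) {n : ℕ} (hn : n ≤ Fintype.card Λ) :
    min (H.minEnergyOn (szSector (n + n) (((n : ℝ) - n) / 2) ⊓
          LinearMap.ker (Matrix.toLin' (spinPlus : Matrix (Finset (Orb Λ)) (Finset (Orb Λ)) ℂ))))
        (sectorGroundEnergy H (n + 1) (n - 1)) ≤ sectorGroundEnergy H n n := by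
  obtain ⟨⟨χ, hχ, hχ0, hHχ⟩, -⟩ := upDownSector_groundState_of_preservesSectors hH hHs hn hn
  rw [← sectorGroundEnergy_def] at hHχ
  rcases spinPlus_mulVec_eq_zero_or_sectorGroundEnergy_le hH hcommP hχ hHχ with h0 | hle
  · refine (min_le_left _ _).trans ?_
    have hmem : χ ∈ szSector (n + n) (((n : ℝ) - n) / 2) ⊓
        LinearMap.ker (Matrix.toLin' (spinPlus : Matrix (Finset (Orb Λ)) (Finset (Orb Λ)) ℂ)) := by
      rw [Submodule.mem_inf, LinearMap.mem_ker, Matrix.toLin'_apply]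
      exact ⟨(mem_szSector_iff_isInSector n n χ).2 hχ, h0⟩
    have hpos : 0 < (star χ ⬝ᵥ χ).re := (Complex.pos_iff.1 (dotProduct_star_self_pos_iff.2 hχ0)).1
    have hray := minEnergyOn_mul_le_re_rayleigh hH _ hmem
    rw [hHχ, dotProduct_smul, smul_eq_mul, Complex.re_ofReal_mul] at hray
    exact le_of_mul_le_mul_right hray hpos
  · exact (min_le_right _ _).trans hle

/-- **Ground vectors of the balanced sector are singlets when the `S_z = 1` sector is gapped**: if
`E(n, n) < E(n + 1, n − 1)` then every eigenvector of `H` in the `(n, n)` sector with eigenvalue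
`E(n, n)` is annihilated by `Ŝ_+`. -/
theorem spinPlus_mulVec_eq_zero_of_sectorGroundEnergy_lt
    {H : Matrix (Finset (Orb Λ)) (Finset (Orb Λ)) ℂ} (hH : H.IsHermitian) (hcommP : Commute H spinPlus)
    {n : ℕ} (hlt : sectorGroundEnergy H n n < sectorGroundEnergy H (n + 1) (n - 1))
    {χ : Fock (Orb Λ)} (hχ : IsInSector n n χ)
    (hHχ : H *ᵥ χ = ((sectorGroundEnergy H n n : ℝ) : ℂ) • χ) : spinPlus *ᵥ χ = 0 :=
  (spinPlus_mulVec_eq_zero_or_sectorGroundEnergy_le hH hcommP hχ hHχ).resolve_right (not_le.2 hlt)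

end Generic

/-! ## The model: `E(n, n) = min (E₀(2n, S = 0), E(n + 1, n − 1))` -/

variable {k : ℕ}

/-- **`min ( E₀(H_F; 2n, S = 0), E(n + 1, n − 1) ) ≤ E(n, n)`** for a symmetric model, `n ≤ k`. -/
theorem Model.min_singletEnergy_energy_le {F : Model k} (hF : F.IsSymmetric) {n : ℕ} (hn : n ≤ k) :
    min (F.singletEnergy n) (F.energy (n + 1) (n - 1)) ≤ F.energy n n :=
  min_singlet_sector_le_sectorGroundEnergy (F.hamiltonian_isHermitian hF)
    F.preservesSectors_hamiltonian (molecularHamiltonian_commute_spinPlus _ _ _) (by simpa using hn)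

/-- **`E(n, n) ≤ E(n + 1, n − 1)`** (one instance of `Model.energy_le_energy_of_max_le`), `1 ≤ n`,
`n + 1 ≤ k`. -/
theorem Model.energy_le_energy_succ_pred {F : Model k} (hF : F.IsSymmetric) {n : ℕ} (hn1 : 1 ≤ n)
    (hn : n + 1 ≤ k) : F.energy n n ≤ F.energy (n + 1) (n - 1) :=
  Model.energy_le_energy_of_max_le hF hn (by omega) (by omega) (by omega)

/-- **`E(n, n) = min ( E₀(H_F; 2n, S = 0), E(n + 1, n − 1) )`** for a symmetric model, `1 ≤ n`,
`n + 1 ≤ k`: the closed-shell sector energy is the singlet energy or the `S_z = 1` sector energy,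
whichever is smaller. -/
theorem Model.energy_eq_min_singletEnergy_energy {F : Model k} (hF : F.IsSymmetric) {n : ℕ}
    (hn1 : 1 ≤ n) (hn : n + 1 ≤ k) :
    F.energy n n = min (F.singletEnergy n) (F.energy (n + 1) (n - 1)) :=
  le_antisymm (le_min (Model.energy_le_singletEnergy hF (by omega))
    (Model.energy_le_energy_succ_pred hF hn1 hn)) (Model.min_singletEnergy_energy_le hF (by omega))

/-! ## Row readings -/

/-- **A singlet `L` and an `S_z = 1` sector `L` give a closed-shell SECTOR `L`** (no assumption on the
spin of the ground state): `SingletLowerRow F n lo`, `LowerRow F (n+1) (n−1) lo'` ⟹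
`LowerRow F n n (min lo lo')`. -/
theorem SingletLowerRow.lowerRow_min {F : Model k} (hF : F.IsSymmetric) {n : ℕ} {lo lo' : ℚ}
    (hS : SingletLowerRow F n lo) (hL : LowerRow F (n + 1) (n - 1) lo') :
    LowerRow F n n (min lo lo') := by
  refine ⟨hS.range, hS.range, ?_⟩
  rw [Rat.cast_min]
  exact (min_le_min hS.le hL.le).trans (Model.min_singletEnergy_energy_le hF hS.range)

/-! ### Certified singlet ground state: singlet `U` below the `S_z = 1` sector `L` -/

/-- **Certified singlet ground state.** A singlet UPPER row `hi` and an `(n+1, n−1)` sector LOWER row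
`lo` with `hi < lo` prove `E(n, n) = E₀(H_F; 2n, S = 0)` and `E₀(2n, S = 0) < E(n + 1, n − 1)`. -/
theorem SingletUpperRow.energy_eq_singletEnergy_of_gap {F : Model k} (hF : F.IsSymmetric) {n : ℕ}
    {hi lo : ℚ} (hU : SingletUpperRow F n hi) (hL : LowerRow F (n + 1) (n - 1) lo) (hgap : hi < lo) :
    F.energy n n = F.singletEnergy n ∧ F.singletEnergy n < F.energy (n + 1) (n - 1) := by
  have hlt : F.singletEnergy n < F.energy (n + 1) (n - 1) :=
    lt_of_le_of_lt hU.le (lt_of_lt_of_le (by exact_mod_cast hgap) hL.le)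
  refine ⟨le_antisymm (Model.energy_le_singletEnergy hF hU.range) ?_, hlt⟩
  have h := Model.min_singletEnergy_energy_le hF hU.range
  rwa [min_eq_left hlt.le] at h

/-- Under a certified singlet ground state, a singlet LOWER row is a sector lower row. -/
theorem SingletLowerRow.lowerRow_of_gap {F : Model k} (hF : F.IsSymmetric) {n : ℕ} {lo₁ hi lo : ℚ}
    (hS : SingletLowerRow F n lo₁) (hU : SingletUpperRow F n hi) (hL : LowerRow F (n + 1) (n - 1) lo)
    (hgap : hi < lo) : LowerRow F n n lo₁ :=
  ⟨hS.range, hS.range,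
    hS.le.trans_eq (SingletUpperRow.energy_eq_singletEnergy_of_gap hF hU hL hgap).1.symm⟩

/-- Under a certified singlet ground state, a singlet BRACKET is a sector bracket. -/
theorem SingletBracket.bracket_of_gap {F : Model k} (hF : F.IsSymmetric) {n : ℕ} {lo₁ hi₁ lo : ℚ}
    (hB : SingletBracket F n lo₁ hi₁) (hL : LowerRow F (n + 1) (n - 1) lo) (hgap : hi₁ < lo) :
    Bracket F n n lo₁ hi₁ :=
  ⟨hB.1.lowerRow_of_gap hF hB.2 hL hgap, hB.2.upperRow hF⟩

/-- Under a certified singlet ground state, a singlet bracket brackets the `2n`-electron ground energy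
of the model. -/
theorem SingletBracket.groundEnergy_mem_of_gap {F : Model k} (hF : F.IsSymmetric) {n : ℕ}
    {lo₁ hi₁ lo : ℚ} (hB : SingletBracket F n lo₁ hi₁) (hL : LowerRow F (n + 1) (n - 1) lo)
    (hgap : hi₁ < lo) :
    ((lo₁ : ℚ) : ℝ) ≤ groundEnergy F.hamiltonian (2 * n) ∧
      groundEnergy F.hamiltonian (2 * n) ≤ ((hi₁ : ℚ) : ℝ) :=
  (hB.bracket_of_gap hF hL hgap).groundEnergy_mem hF

/-- **The MODEL's `2n`-electron ground states in `S_z = 0` are singlets**, certified: under the gap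
hypotheses every eigenvector of `H_F` in the `(n, n)` sector at the sector energy is annihilated by
`Ŝ_+`. -/
theorem spinPlus_mulVec_eq_zero_of_gap {F : Model k} (hF : F.IsSymmetric) {n : ℕ} {hi lo : ℚ}
    (hU : SingletUpperRow F n hi) (hL : LowerRow F (n + 1) (n - 1) lo) (hgap : hi < lo)
    {χ : Fock (Orb (Fin k))} (hχ : IsInSector n n χ)
    (hHχ : F.hamiltonian *ᵥ χ = ((F.energy n n : ℝ) : ℂ) • χ) : spinPlus *ᵥ χ = 0 := by
  have h := SingletUpperRow.energy_eq_singletEnergy_of_gap hF hU hL hgap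
  exact spinPlus_mulVec_eq_zero_of_sectorGroundEnergy_lt (F.hamiltonian_isHermitian hF)
    (molecularHamiltonian_commute_spinPlus _ _ _) (by rw [← Model.energy, h.1]; exact h.2) hχ hHχ

/-! ### Certified non-singlet ground state: `S_z = 1` sector `U` below the singlet `L` -/

/-- **Certified non-singlet ground state.** A singlet LOWER row `lo` and an `(n+1, n−1)` sector UPPER
row `hi` with `hi < lo` (`1 ≤ n`) prove `E(n, n) = E(n + 1, n − 1) < E₀(H_F; 2n, S = 0)`: the
`2n`-electron ground multiplet of the model contains no singlet. -/
theorem SingletLowerRow.energy_eq_energy_of_gap {F : Model k} (hF : F.IsSymmetric) {n : ℕ}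
    {lo hi : ℚ} (hS : SingletLowerRow F n lo) (hU : UpperRow F (n + 1) (n - 1) hi) (hgap : hi < lo)
    (hn1 : 1 ≤ n) :
    F.energy n n = F.energy (n + 1) (n - 1) ∧ F.energy n n < F.singletEnergy n := by
  have hlt : F.energy (n + 1) (n - 1) < F.singletEnergy n :=
    lt_of_le_of_lt hU.le (lt_of_lt_of_le (by exact_mod_cast hgap) hS.le)
  have h := Model.min_singletEnergy_energy_le hF hS.range
  rw [min_eq_right hlt.le] at h
  have heq : F.energy n n = F.energy (n + 1) (n - 1) :=
    le_antisymm (Model.energy_le_energy_succ_pred hF hn1 hU.range.1) h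
  exact ⟨heq, heq ▸ hlt⟩

/-- Under a certified non-singlet ground state, an `(n+1, n−1)` sector bracket is an `(n, n)` sector
bracket (and hence, by `Rows/NSector.lean`, an `E₀(2n)` bracket). -/
theorem Bracket.bracket_pred_of_gap {F : Model k} (hF : F.IsSymmetric) {n : ℕ} {lo' hi lo : ℚ}
    (hB : Bracket F (n + 1) (n - 1) lo' hi) (hS : SingletLowerRow F n lo) (hgap : hi < lo)
    (hn1 : 1 ≤ n) : Bracket F n n lo' hi := by
  have h := SingletLowerRow.energy_eq_energy_of_gap hF hS hB.2 hgap hn1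
  exact ⟨⟨hS.range, hS.range, hB.1.le.trans_eq h.1.symm⟩,
    ⟨hS.range, hS.range, h.1.trans_le hB.2.le⟩⟩

end Summit.Ventures.CertifiedQuantumChemistry

end
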